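import Mathlib
import Summits.ResolutionOfSingularities.ResolutionOfSingularities.Theorems.WeightedInvariantLocalWeightedDropNCDirectrixCutPairLiftStart
import Summits.ResolutionOfSingularities.ResolutionOfSingularities.Theorems.WeightedInvariantLocalWeightedDropTOT2EndBridge

/-!
# `WeightedInvariant.LocalWeightedDrop`: LINE `directrix-cut`, SNC₂ — THE x₀-LIFT (5/5): ASSEMBLY — `pairLift_of_dbWinsTo`, `pairLift`, `pairLift_three`

OURS (res-L1-w43-stub-4 g6 for the ENGINE crux `LocalWeightedDrop` stmt-ResolutionOfSingularities-8899, W′|₄ line, R₂ corner, piece LIFT of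
res-L1-w43-strat-1's `stub_pairLift` (g11 `snc2_interface_v1.lean` e57a74989d55635b); candidates, not facts; counted 0).  THE x₀-LIFT transports a
`(m+1)`-variable B-permissible decorated strategy (`TameFourTupleDrop.DBWinsTo`, res-L1-w43-lead-1 p575221) along the product structure of a pair
position `Φ^*f = u · X₀ · (X₀ + g(x₁…x_{m+1}))`: lifted moves `(Φ;Λ(Ψ), (1,w))` with `Λ(Ψ) = (X₀, rename succ ∘ Ψ)`; answers with `c₀ ≠ 0` exit by a
head drop, answers with `c₀ = 0` are pair positions over the shadow's transform, normal-crossing shadows are monomial pair positions.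

THIS FILE: the ENGINE `pairLift_of_dbWinsTo` (region = pair positions over shadows in the three-variable region, rank = least shadow rank,
`DWinsTo.of_measure`), `pairLift` (START + ENGINE, every dimension `m + 2 ≥ 2`, every field), and `pairLift_three` = res-L1-w43-strat-1's
`stub_pairLift` with the shadow engine D₃ᴮ in the tree currency `DBWinsTo` and the characteristic binders `(p) (hp) [CharP k p]` moved onto the
conclusion (the stub's own conclusion quantifies over all algebraically closed fields while its hypothesis only speaks in prime characteristic).
-/

set_option linter.dupNamespace false

noncomputable section

namespace Summit.ResolutionOfSingularities.ResolutionOfSingularities.Theorems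

namespace TameFourTupleDrop

namespace PairLift

open MvPowerSeries Literature.AlgebraicGeometry.Resolution

variable {k : Type} [Field k]

/-! # PART 9 — the lift: assembly -/

section Lift

variable {m : ℕ}

/-- **A UNIT STRICT TRANSFORM DROPS THE HEAD** (any dimension; `o ≥ 1`). -/
theorem head_lt_of_constantCoeff_strict' {δ : Decoration k m} {Φ : Fin (m + 1) → MvPowerSeries (Fin (m + 1)) k} {w : Fin (m + 1) → ℕ}
    {c : Fin (m + 1) → k} (hperm : IsBPermissible δ Φ w) (hc : ∀ l, w l = 0 → c l = 0) (hf0 : δ.f ≠ 0) {j : Fin (m + 1)} (hcj : c j ≠ 0)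
    (ho : 1 ≤ δ.o) (hunit : constantCoeff (δ.strict Φ w c j) ≠ 0) : (δ.transform Φ w c j).head < δ.head := by
  refine lt_of_le_of_ne (Decoration.head_transform_le hperm hc hf0 hcj) fun heq => ?_
  have ho' := Decoration.o_transform_of_head_eq heq
  have hf' := Decoration.transform_f_eq_strict_of_o_transform_eq hperm hc hf0 hcj ho'
  have h0 : (δ.transform Φ w c j).o = 0 := by
    rw [Decoration.o, hf', ENat.toNat_eq_zero]
    left
    by_contra hne
    exact hunit (order_ne_zero_iff_constCoeff_eq_zero.mp hne)
  omega

/-- An admissibly decorated position whose equation is a unit is a normal crossing; so off normal crossings `f(0) = 0`. -/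
theorem constantCoeff_f_eq_zero_of_not_germIsNC {b : MvPowerSeries (Fin (m + 1)) k} {δ : Decoration k m} (hadm : Admissible b δ)
    (hnc : ¬ GermIsNC b) : constantCoeff δ.f = 0 := by
  by_contra hne
  refine hnc (germIsNC_of_admissible_of_o_eq_zero hadm ?_)
  rw [Decoration.o, order_eq_zero_of_constantCoeff_ne_zero hne]
  rfl

/-- **THE x₀-LIFT (ENGINE).**  From a pair position `Φ^*f = u · X₀ · (X₀ + g₃)` (`o = 2`, `O = ∅`, boundary letters over shadow letters) with an
ADMISSIBLE SHADOW `(b₃, δ₃)` (`f₃ ∣ g₃^N`, `g₃ ∣ b₃^a`) from which the three-variable mover B-FORCES NORMAL CROSSINGS, the four-variable mover forces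
«EXIT (NC, or admissible with smaller head, or same head and not unary), or a MONOMIAL PAIR position with the same head». OURS: the lifted region
is `{pair positions over shadows in the three-variable region}`, ranked by the least rank of a shadow; lifted moves `(Φ;Λ(Ψ), (1,w))`; answers with
`c₀ ≠ 0` exit by head drop, answers with `c₀ = 0` are pair positions over the shadow's transform, normal-crossing shadows are monomial pairs. -/
theorem pairLift_of_dbWinsTo {b : MvPowerSeries (Fin (m + 1 + 1)) k} {δ : Decoration k (m + 1)} (hadm : Admissible b δ) (hO : δ.O = ∅)
    (ho : δ.o = 2) {Φ : Fin (m + 1 + 1) → MvPowerSeries (Fin (m + 1 + 1)) k} (hΦ0 : ∀ l, constantCoeff (Φ l) = 0)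
    (hΦdet : IsUnit (Matrix.det (Matrix.of fun i j => coeff (Finsupp.single j 1) (Φ i)))) {u : MvPowerSeries (Fin (m + 1 + 1)) k}
    {g₃ b₃ : MvPowerSeries (Fin (m + 1)) k} {δ₃ : Decoration k m}
    (hE : ∀ l ∈ δ.E, ∃ (j : Fin (m + 1)) (v : MvPowerSeries (Fin (m + 1 + 1)) k), constantCoeff v ≠ 0 ∧ Φ l = v * X j.succ ∧ j ∈ δ₃.E)
    (hu : constantCoeff u ≠ 0) (hf : subst Φ δ.f = u * (X 0 * (X 0 + rename (Fin.succEmb (m + 1)) g₃))) (hadm₃ : Admissible b₃ δ₃)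
    {N a : ℕ} (hN : δ₃.f ∣ g₃ ^ N) (ha : g₃ ∣ b₃ ^ a)
    (hD : DBWinsTo (fun τ : MvPowerSeries (Fin (m + 1)) k × Decoration k m => GermIsNC τ.1) (b₃, δ₃)) :
    DWinsTo (St := MvPowerSeries (Fin (m + 1 + 1)) k × Decoration k (m + 1)) Prod.fst
      (fun τ => (GermIsNC τ.1 ∨ (Admissible τ.1 τ.2 ∧ (τ.2.head < δ.head ∨ (τ.2.head = δ.head ∧ ¬ UnaryVertex τ.2)))) ∨
        (Admissible τ.1 τ.2 ∧ τ.2.head = δ.head ∧ τ.2.O = ∅ ∧ τ.2.o = 2 ∧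
          ∃ (Φ' : Fin (m + 1 + 1) → MvPowerSeries (Fin (m + 1 + 1)) k) (u' v : MvPowerSeries (Fin (m + 1 + 1)) k) (α : Fin (m + 1) → ℕ),
            (∀ i, constantCoeff (Φ' i) = 0) ∧ IsUnit (Matrix.det (Matrix.of fun i j => coeff (Finsupp.single j 1) (Φ' i))) ∧
            (∀ l ∈ τ.2.E, ∃ (l' : Fin (m + 1 + 1)) (w : MvPowerSeries (Fin (m + 1 + 1)) k), l' ≠ 0 ∧ constantCoeff w ≠ 0 ∧ Φ' l = w * X l') ∧
            constantCoeff u' ≠ 0 ∧ constantCoeff v ≠ 0 ∧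
            subst Φ' τ.2.f = u' * (X 0 * (X 0 + v * ∏ i : Fin (m + 1), X (Fin.succ i) ^ α i))))
      (b, δ) := by
  classical
  obtain ⟨T, ρ, hT, hσ₃⟩ := hD
  -- the shadows of a position: members of the region carrying the pair datum
  set W : MvPowerSeries (Fin (m + 1 + 1)) k × Decoration k (m + 1) → MvPowerSeries (Fin (m + 1)) k × Decoration k m → Prop :=
    fun σ τ => τ ∈ T ∧ Admissible τ.1 τ.2 ∧
      ∃ (Φ : Fin (m + 1 + 1) → MvPowerSeries (Fin (m + 1 + 1)) k) (u : MvPowerSeries (Fin (m + 1 + 1)) k) (g : MvPowerSeries (Fin (m + 1)) k),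
        (∀ l, constantCoeff (Φ l) = 0) ∧ IsUnit (Matrix.det (Matrix.of fun i j => coeff (Finsupp.single j 1) (Φ i))) ∧
        (∀ l ∈ σ.2.E, ∃ (j : Fin (m + 1)) (v : MvPowerSeries (Fin (m + 1 + 1)) k), constantCoeff v ≠ 0 ∧ Φ l = v * X j.succ ∧ j ∈ τ.2.E) ∧
        constantCoeff u ≠ 0 ∧ subst Φ σ.2.f = u * (X 0 * (X 0 + rename (Fin.succEmb (m + 1)) g)) ∧ (∃ N, τ.2.f ∣ g ^ N) ∧ ∃ a, g ∣ τ.1 ^ a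
    with hWdef
  set C : Set (MvPowerSeries (Fin (m + 1 + 1)) k × Decoration k (m + 1)) :=
    {σ | Admissible σ.1 σ.2 ∧ σ.2.O = ∅ ∧ σ.2.o = 2 ∧ σ.2.head = δ.head ∧ ∃ τ, W σ τ} with hCdef
  refine DWinsTo.of_measure C (fun σ => sInf (ρ '' {τ | W σ τ})) ?_
    ⟨hadm, hO, ho, rfl, (b₃, δ₃), hσ₃, hadm₃, Φ, u, g₃, hΦ0, hΦdet, hE, hu, hf, ⟨N, hN⟩, ⟨a, ha⟩⟩
  rintro ⟨b₁, δ₁⟩ ⟨hadm₁, hO₁, ho₁, hhead₁, hne⟩ hQ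
  dsimp only at hadm₁ hO₁ ho₁ hhead₁
  -- a shadow of least rank
  have hne' : (ρ '' {τ | W (b₁, δ₁) τ}).Nonempty := by obtain ⟨τ, hτ⟩ := hne; exact ⟨ρ τ, τ, hτ, rfl⟩
  obtain ⟨τ, hWτ, hρτ⟩ := (Set.mem_image _ _ _).mp (csInf_mem hne')
  obtain ⟨hτT, hadmτ, Φ₁, u₁, g, hΦ₁0, hΦ₁det, hE₁, hu₁, hf₁, ⟨N₁, hN₁⟩, ⟨a₁, ha₁⟩⟩ := hWτ
  -- the shadow is not a normal crossing (else the position is a monomial pair)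
  have hnc : ¬ GermIsNC τ.1 := fun hnc =>
    hQ (Or.inr ⟨hadm₁, hhead₁, hO₁, ho₁, monomialPair_of_germIsNC hΦ₁0 hΦ₁det hu₁ hf₁ hadmτ hE₁ ha₁ hnc⟩)
  -- the region's B-permissible move and its lift
  obtain ⟨Ψ, w, hperm, hcl⟩ := hT τ hτT hnc
  have hΨ0 := hperm.1.1
  have hΨdet := hperm.1.2.1
  have hw := hperm.1.2.2.1
  have hf₃0 : constantCoeff τ.2.f = 0 := constantCoeff_f_eq_zero_of_not_germIsNC hadmτ hnc
  have hf₃ne : τ.2.f ≠ 0 := hadmτ.2.1.ne_zero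
  have hb₃ne : τ.1 ≠ 0 := ne_zero_of_admissible hadmτ
  have hg1 : (1 : ℕ∞) ≤ (subst Ψ g).weightedOrder w := one_le_weightedOrder_subst_of_dvd hperm hf₃0 hN₁
  have hperm₄ := isBPermissible_liftMove hO₁ hΦ₁0 hΦ₁det hu₁ hf₁ hE₁ hperm hg1
  have hf0 : δ₁.f ≠ 0 := hadm₁.2.1.ne_zero
  have ho₁' : 1 ≤ δ₁.o := by omega
  refine ⟨_, (Fin.cons 1 w : Fin (m + 1 + 1) → ℕ), hperm₄.1, ?_⟩
  -- the answers, written `c = (c₀, c₃)`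
  suffices H : ∀ (c₀ : k) (c₃ : Fin (m + 1) → k),
      (∀ i, (Fin.cons 1 w : Fin (m + 1 + 1) → ℕ) i = 0 → (Fin.cons c₀ c₃ : Fin (m + 1 + 1) → k) i = 0) →
      (Fin.cons c₀ c₃ : Fin (m + 1 + 1) → k) ≠ 0 →
      ∀ (A : ℕ) (G : MvPowerSeries (Fin (m + 1 + 1 + 1)) k),
        subst (CobordantChart.chart (Fin.cons 1 w : Fin (m + 1 + 1) → ℕ) (Fin.cons c₀ c₃ : Fin (m + 1 + 1) → k))
            (subst (fun l => subst ((Fin.cons (X 0) (fun j => rename (Fin.succEmb (m + 1)) (Ψ j)) :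
              Fin (m + 1 + 1) → MvPowerSeries (Fin (m + 1 + 1)) k)) (Φ₁ l)) b₁) = X 0 ^ A * G →
        ¬ (X (0 : Fin (m + 1 + 1 + 1)) ∣ G) →
        ∃ i : Fin (m + 1 + 1), (Fin.cons c₀ c₃ : Fin (m + 1 + 1) → k) i ≠ 0 ∧
          ∃ τ' : MvPowerSeries (Fin (m + 1 + 1)) k × Decoration k (m + 1), τ'.1 = X 0 * TupleGame.slice i G ∧
            (((GermIsNC τ'.1 ∨ (Admissible τ'.1 τ'.2 ∧ (τ'.2.head < δ.head ∨ (τ'.2.head = δ.head ∧ ¬ UnaryVertex τ'.2)))) ∨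
              (Admissible τ'.1 τ'.2 ∧ τ'.2.head = δ.head ∧ τ'.2.O = ∅ ∧ τ'.2.o = 2 ∧
                ∃ (Φ' : Fin (m + 1 + 1) → MvPowerSeries (Fin (m + 1 + 1)) k) (u' v : MvPowerSeries (Fin (m + 1 + 1)) k) (α : Fin (m + 1) → ℕ),
                  (∀ i, constantCoeff (Φ' i) = 0) ∧ IsUnit (Matrix.det (Matrix.of fun i j => coeff (Finsupp.single j 1) (Φ' i))) ∧
                  (∀ l ∈ τ'.2.E, ∃ (l' : Fin (m + 1 + 1)) (w : MvPowerSeries (Fin (m + 1 + 1)) k),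
                    l' ≠ 0 ∧ constantCoeff w ≠ 0 ∧ Φ' l = w * X l') ∧
                  constantCoeff u' ≠ 0 ∧ constantCoeff v ≠ 0 ∧
                  subst Φ' τ'.2.f = u' * (X 0 * (X 0 + v * ∏ i : Fin (m + 1), X (Fin.succ i) ^ α i)))) ∨
            (τ' ∈ C ∧ sInf (ρ '' {τ | W τ' τ}) < sInf (ρ '' {τ | W (b₁, δ₁) τ}))) by
    intro c hc hcne A G hfac hG
    have h := H (c 0) (Fin.tail c)
    simp only [Fin.cons_self_tail] at h
    exact h hc hcne A G hfac hG
  intro c₀ c₃ hc hcne A G hfac hG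
  have hc₃ : ∀ j, w j = 0 → c₃ j = 0 := fun j hj => by
    have := hc j.succ (by rw [Fin.cons_succ]; exact hj)
    rwa [Fin.cons_succ] at this
  have hgen : ∀ i, (Fin.cons c₀ c₃ : Fin (m + 1 + 1) → k) i ≠ 0 →
      Admissible (X 0 * TupleGame.slice i G) (δ₁.transform (fun l => subst ((Fin.cons (X 0) (fun j => rename (Fin.succEmb (m + 1)) (Ψ j)) :
        Fin (m + 1 + 1) → MvPowerSeries (Fin (m + 1 + 1)) k)) (Φ₁ l)) (Fin.cons 1 w : Fin (m + 1 + 1) → ℕ)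
        (Fin.cons c₀ c₃ : Fin (m + 1 + 1) → k) i) := fun i hi => admissible_transform hadm₁ hperm₄ hc hfac hG hi
  by_cases hc₃0 : c₃ = 0
  · -- (a) the point `(c₀ : 0)`, slot `0`: the strict transform is a unit, the head drops
    subst hc₃0
    have hc₀ : c₀ ≠ 0 := by
      intro h
      apply hcne
      funext i
      refine Fin.cases ?_ (fun j => ?_) i
      · rw [Fin.cons_zero, h, Pi.zero_apply]
      · rw [Fin.cons_succ, Pi.zero_apply, Pi.zero_apply]
    obtain ⟨Γ, hΓ⟩ := exists_eq_X_zero_mul_of_one_le_weightedOrder w (fun _ => (0 : k)) (fun _ _ => rfl) hg1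
    have hΓ0 := constantCoeff_eq_zero_of_chart_zero w hΓ
    have hunit := constantCoeff_strict_lift_slot_zero (δ := δ₁) hΦ₁0 hΦ₁det hu₁ hf₁ hf0 hΨ0 hΨdet hw hc₀ le_rfl
      (by rw [pow_one]; exact hΓ) hΓ0
    have hc0' : (Fin.cons c₀ (0 : Fin (m + 1) → k) : Fin (m + 1 + 1) → k) 0 ≠ 0 := by rw [Fin.cons_zero]; exact hc₀
    refine ⟨0, hc0', (X 0 * TupleGame.slice 0 G, _), rfl, Or.inl (Or.inl (Or.inr ⟨hgen 0 hc0', Or.inl ?_⟩))⟩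
    rw [← hhead₁]
    exact head_lt_of_constantCoeff_strict' hperm₄ hc hf0 hc0' ho₁' hunit
  · obtain ⟨j, hj⟩ : ∃ j, c₃ j ≠ 0 := by
      by_contra hno
      push Not at hno
      exact hc₃0 (funext hno)
    have hcj : (Fin.cons c₀ c₃ : Fin (m + 1 + 1) → k) j.succ ≠ 0 := by rw [Fin.cons_succ]; exact hj
    obtain ⟨Γ, hΓ⟩ := exists_eq_X_zero_mul_of_one_le_weightedOrder w c₃ hc₃ hg1
    have hΓ' : subst (CobordantChart.chart w c₃) (subst Ψ g) = X 0 ^ 1 * Γ := by rw [pow_one]; exact hΓ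
    by_cases hc₀ : c₀ ≠ 0
    · -- (b1) `c₀ ≠ 0`, slot `j + 1`: the order drops to `≤ 1`
      have ho' := o_transform_lift_slot_succ_le_one (δ := δ₁) hΦ₁0 hΦ₁det hu₁ hf₁ hf0 hΨ0 hΨdet hw hc₃ hc₀ le_rfl hΓ' j
      refine ⟨j.succ, hcj, (X 0 * TupleGame.slice j.succ G, _), rfl, Or.inl (Or.inl (Or.inr ⟨hgen _ hcj, Or.inl ?_⟩))⟩
      rw [← hhead₁]
      exact Decoration.head_transform_lt_of_o_lt (by rw [ho₁]; omega)
    · -- (b2) `c₀ = 0`: follow the shadow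
      rw [not_ne_iff] at hc₀
      subst hc₀
      have hc₃ne : c₃ ≠ 0 := fun h => hc₃0 h
      obtain ⟨A₃, G₃, hfac₃, hG₃⟩ := CobordantVertexChart.exists_eq_X_pow_mul_not_dvd
        (CobordantChart.subst_chart_ne_zero w c₃ hc₃ (subst_ne_zero_of_isCountMove hperm.1 hb₃ne))
      obtain ⟨i₃, hci₃, hτ'T, hρlt⟩ := hcl c₃ hc₃ hc₃ne A₃ G₃ hfac₃ hG₃
      have hci : (Fin.cons (0 : k) c₃ : Fin (m + 1 + 1) → k) i₃.succ ≠ 0 := by rw [Fin.cons_succ]; exact hci₃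
      set δ' := δ₁.transform (fun l => subst ((Fin.cons (X 0) (fun j => rename (Fin.succEmb (m + 1)) (Ψ j)) :
        Fin (m + 1 + 1) → MvPowerSeries (Fin (m + 1 + 1)) k)) (Φ₁ l)) (Fin.cons 1 w : Fin (m + 1 + 1) → ℕ)
        (Fin.cons (0 : k) c₃ : Fin (m + 1 + 1) → k) i₃.succ with hδ'
      by_cases hlt : δ'.head < δ₁.head
      · refine ⟨i₃.succ, hci, (X 0 * TupleGame.slice i₃.succ G, δ'), rfl, Or.inl (Or.inl (Or.inr ⟨hgen _ hci, Or.inl ?_⟩))⟩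
        rw [← hhead₁]
        exact hlt
      · have heq : δ'.head = δ₁.head := le_antisymm (Decoration.head_transform_le hperm₄ hc hf0 hci) (not_lt.mp hlt)
        -- the new position is a pair position over the shadow's transform
        set τ' : MvPowerSeries (Fin (m + 1)) k × Decoration k m := (X 0 * TupleGame.slice i₃ G₃, τ.2.transform Ψ w c₃ i₃) with hτ'
        have hstrict := strict_lift_slot_succ (δ := δ₁) hΦ₁0 hΦ₁det hu₁ hf₁ hf0 hΨ0 hΨdet hw hc₃ le_rfl hΓ' i₃
        have hf' : δ'.f = _ := Decoration.transform_f_eq_strict_of_o_transform_eq hperm₄ hc hf0 hci (Decoration.o_transform_of_head_eq heq)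
        set U' := TupleGame.slice i₃.succ (subst (CobordantChart.chart (Fin.cons 1 w : Fin (m + 1 + 1) → ℕ) (Fin.cons (0 : k) c₃ : Fin (m + 1 + 1) → k))
          (subst ((Fin.cons (X 0) (fun j => rename (Fin.succEmb (m + 1)) (Ψ j)) : Fin (m + 1 + 1) → MvPowerSeries (Fin (m + 1 + 1)) k)) u₁))
          with hU'
        have hU'0 : constantCoeff U' ≠ 0 := by
          rw [hU', constantCoeff_slice, constantCoeff_subst_chart_cons hc₃, TOT2E1.constantCoeff_subst_of_constantCoeff_zero _ (constantCoeff_liftFam hΨ0)]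
          exact hu₁
        have hW' : W (X 0 * TupleGame.slice i₃.succ G, δ') τ' := by
          refine ⟨hτ'T, admissible_transform hadmτ hperm hc₃ hfac₃ hG₃ hci₃,
            fun l => (X (Equiv.swap (0 : Fin (m + 1 + 1)) 1 l) : MvPowerSeries (Fin (m + 1 + 1)) k),
            rename (Equiv.swap (0 : Fin (m + 1 + 1)) 1) U', TupleGame.slice i₃ Γ, fun _ => constantCoeff_X _, isUnit_det_X_swap m,
            letters_transform_lift hE₁ hperm hci₃ 0 _, by rw [MvPowerSeries.constantCoeff_rename]; exact hU'0, ?_,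
            ⟨N₁, ?_⟩, ⟨a₁ * A₃ + a₁, slice_dvd_pow_of_dvd_pow hΨ0 hc₃ ha₁ hΓ hfac₃ i₃⟩⟩
          · show subst _ δ'.f = _
            rw [subst_X_swap, hf', hstrict, rename_swap_pair, Nat.sub_self, pow_zero, one_mul]
          · show (τ.2.transform Ψ w c₃ i₃).f ∣ TupleGame.slice i₃ Γ ^ N₁
            rw [Decoration.transform_f]
            exact (sqfRep_dvd _).trans (strict_dvd_pow_of_dvd_pow hperm.1 hc₃ hf₃ne hN₁ hΓ i₃)
        refine ⟨i₃.succ, hci, (X 0 * TupleGame.slice i₃.succ G, δ'), rfl, Or.inr ⟨⟨hgen _ hci, Decoration.transform_O_eq_empty_of_head_eq hO₁ heq,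
          (Decoration.o_transform_of_head_eq heq).trans ho₁, heq.trans hhead₁, τ', hW'⟩, ?_⟩⟩
        calc sInf (ρ '' {τ | W (X 0 * TupleGame.slice i₃.succ G, δ') τ}) ≤ ρ τ' := csInf_le' ⟨τ', hW', rfl⟩
          _ < ρ τ := hρlt
          _ = sInf (ρ '' {τ | W (b₁, δ₁) τ}) := hρτ

end Lift

/-! # PART 10 — SNC₂'s LIFT: two smooth branches over a winning shadow engine -/

section PairLift

variable {m : ℕ}

/-- **THE x₀-LIFT.**  If from every admissibly decorated three-variable position with empty history the mover B-forces normal crossings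
(`DBWinsTo`, the tree's B-permissible decorated wins), then from two smooth branches `Φ^*f = u · (X₀ + g₁) · (X₀ + g₂)` at `o = 2`, `O = ∅`,
boundary straight off `X₀`, the mover forces «EXIT, or a MONOMIAL PAIR position with the same head» (START `exists_start` + ENGINE
`pairLift_of_dbWinsTo`). -/
theorem pairLift
    (hD : ∀ (b₃ : MvPowerSeries (Fin (m + 1)) k) (δ₃ : Decoration k m), Admissible b₃ δ₃ → δ₃.O = ∅ →
      DBWinsTo (fun τ : MvPowerSeries (Fin (m + 1)) k × Decoration k m => GermIsNC τ.1) (b₃, δ₃))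
    {b : MvPowerSeries (Fin (m + 1 + 1)) k} {δ : Decoration k (m + 1)} (hadm : Admissible b δ) (hO : δ.O = ∅) (ho : δ.o = 2)
    {Φ : Fin (m + 1 + 1) → MvPowerSeries (Fin (m + 1 + 1)) k} (hΦ0 : ∀ i, constantCoeff (Φ i) = 0)
    (hΦdet : IsUnit (Matrix.det (Matrix.of fun i j => coeff (Finsupp.single j 1) (Φ i))))
    (hE : ∀ l ∈ δ.E, ∃ (l' : Fin (m + 1 + 1)) (v : MvPowerSeries (Fin (m + 1 + 1)) k), l' ≠ 0 ∧ constantCoeff v ≠ 0 ∧ Φ l = v * X l')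
    {u g₁ g₂ : MvPowerSeries (Fin (m + 1 + 1)) k} (hu : constantCoeff u ≠ 0) (hg₁ : ∀ d : Fin (m + 1 + 1) →₀ ℕ, d 0 ≠ 0 → coeff d g₁ = 0)
    (hg₂ : ∀ d : Fin (m + 1 + 1) →₀ ℕ, d 0 ≠ 0 → coeff d g₂ = 0) (hf : subst Φ δ.f = u * ((X 0 + g₁) * (X 0 + g₂))) :
    DWinsTo (St := MvPowerSeries (Fin (m + 1 + 1)) k × Decoration k (m + 1)) Prod.fst
      (fun τ => (GermIsNC τ.1 ∨ (Admissible τ.1 τ.2 ∧ (τ.2.head < δ.head ∨ (τ.2.head = δ.head ∧ ¬ UnaryVertex τ.2)))) ∨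
        (Admissible τ.1 τ.2 ∧ τ.2.head = δ.head ∧ τ.2.O = ∅ ∧ τ.2.o = 2 ∧
          ∃ (Φ' : Fin (m + 1 + 1) → MvPowerSeries (Fin (m + 1 + 1)) k) (u' v : MvPowerSeries (Fin (m + 1 + 1)) k) (α : Fin (m + 1) → ℕ),
            (∀ i, constantCoeff (Φ' i) = 0) ∧ IsUnit (Matrix.det (Matrix.of fun i j => coeff (Finsupp.single j 1) (Φ' i))) ∧
            (∀ l ∈ τ.2.E, ∃ (l' : Fin (m + 1 + 1)) (w : MvPowerSeries (Fin (m + 1 + 1)) k), l' ≠ 0 ∧ constantCoeff w ≠ 0 ∧ Φ' l = w * X l') ∧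
            constantCoeff u' ≠ 0 ∧ constantCoeff v ≠ 0 ∧
            subst Φ' τ.2.f = u' * (X 0 * (X 0 + v * ∏ i : Fin (m + 1), X (Fin.succ i) ^ α i))))
      (b, δ) := by
  obtain ⟨Φ₁, u₁, g₃, b₃, δ₃, hΦ₁0, hΦ₁det, hE₁, hu₁, hf₁, hadm₃, hO₃, hN, ha⟩ := exists_start hadm ho hΦ0 hΦdet hE hu hg₁ hg₂ hf
  exact pairLift_of_dbWinsTo hadm hO ho hΦ₁0 hΦ₁det hE₁ hu₁ hf₁ hadm₃ hN ha (hD b₃ δ₃ hadm₃ hO₃)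

/-- **SNC₂'s LIFT AT `m + 1 = 3`** — res-L1-w43-strat-1's `stub_pairLift` (g11 `snc2_interface_v1.lean`) with the shadow engine D₃ᴮ in the tree's
currency `TameFourTupleDrop.DBWinsTo` (res-L1-w43-lead-1, p575221) and the characteristic binders `(p) (hp) [CharP k p]` that D₃ᴮ carries put on
the conclusion (the consumer is `p = 2`): the liftable surface engine gives the smooth-pair step. -/
theorem pairLift_three
    (hD : ∀ (p : ℕ), p.Prime → ∀ (k : Type) [Field k] [CharP k p] [IsAlgClosed k],
      ∀ (b : MvPowerSeries (Fin 3) k) (δ : Decoration k 2), Admissible b δ → δ.O = ∅ →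
        DBWinsTo (fun τ : MvPowerSeries (Fin 3) k × Decoration k 2 => GermIsNC τ.1) (b, δ)) :
    ∀ (p : ℕ), p.Prime → ∀ (k : Type) [Field k] [CharP k p] [IsAlgClosed k],
      ∀ (b : MvPowerSeries (Fin 4) k) (δ : Decoration k 3) (Φ : Fin 4 → MvPowerSeries (Fin 4) k) (u g₁ g₂ : MvPowerSeries (Fin 4) k),
        Admissible b δ → δ.O = ∅ → δ.o = 2 →
        (∀ i, constantCoeff (Φ i) = 0) → IsUnit (Matrix.det (Matrix.of fun i j => coeff (Finsupp.single j 1) (Φ i))) →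
        (∀ l ∈ δ.E, ∃ (l' : Fin 4) (v : MvPowerSeries (Fin 4) k), l' ≠ 0 ∧ constantCoeff v ≠ 0 ∧ Φ l = v * X l') →
        constantCoeff u ≠ 0 → (∀ n : Fin 4 →₀ ℕ, n 0 ≠ 0 → coeff n g₁ = 0) → (∀ n : Fin 4 →₀ ℕ, n 0 ≠ 0 → coeff n g₂ = 0) →
        subst Φ δ.f = u * ((X 0 + g₁) * (X 0 + g₂)) →
        DWinsTo (St := MvPowerSeries (Fin 4) k × Decoration k 3) Prod.fst
          (fun τ => (GermIsNC τ.1 ∨ (Admissible τ.1 τ.2 ∧ (τ.2.head < δ.head ∨ (τ.2.head = δ.head ∧ ¬ UnaryVertex τ.2)))) ∨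
            (Admissible τ.1 τ.2 ∧ τ.2.head = δ.head ∧ τ.2.O = ∅ ∧ τ.2.o = 2 ∧
              ∃ (Φ' : Fin 4 → MvPowerSeries (Fin 4) k) (u' v : MvPowerSeries (Fin 4) k) (α : Fin 3 → ℕ),
                (∀ i, constantCoeff (Φ' i) = 0) ∧ IsUnit (Matrix.det (Matrix.of fun i j => coeff (Finsupp.single j 1) (Φ' i))) ∧
                (∀ l ∈ τ.2.E, ∃ (l' : Fin 4) (w : MvPowerSeries (Fin 4) k), l' ≠ 0 ∧ constantCoeff w ≠ 0 ∧ Φ' l = w * X l') ∧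
                constantCoeff u' ≠ 0 ∧ constantCoeff v ≠ 0 ∧
                subst Φ' τ.2.f = u' * (X 0 * (X 0 + v * ∏ i : Fin 3, X (Fin.succ i) ^ α i))))
          (b, δ) := by
  intro p hp k _ _ _ b δ Φ u g₁ g₂ hadm hO ho hΦ0 hΦdet hE hu hg₁ hg₂ hf
  exact pairLift (m := 2) (fun b₃ δ₃ h₃ hO₃ => hD p hp k b₃ δ₃ h₃ hO₃) hadm hO ho hΦ0 hΦdet hE hu hg₁ hg₂ hf

end PairLift

end PairLift

end TameFourTupleDrop

end Summit.ResolutionOfSingularities.ResolutionOfSingularities.Theorems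

end
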